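import Literature.AlgebraicGeometry.Frobenioids.ModelFrobenioid
import Literature.AlgebraicGeometry.Frobenioids.Categories
import Mathlib.CategoryTheory.Comma.Over.Basic
import HarnessLib

/-!
# Frobenioids I, Remark 1.13.1 for model Frobenioids: a divisible family of `Div_B`-trivial natural units
# makes the model Frobenioid of Theorem 5.2 NON-slim

Mochizuki, *The geometry of Frobenioids I: the general theory*, Kyushu J. Math. **62** (2008) 293–400, §1,
Remark 1.13.1, kurims pp. 40–41 [cite: MochizukiFrdI2008, Rem. 1.13.1 p.40] ("if the hypothesis of
Proposition 1.13, (iii), fails to hold, then it is not necessarily the case that `C` is slim … any collection of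
elements `{αₙ}` … such that [`αₙ` is an `n`-th root system] determines an automorphism of the natural functor
`C_A → C` … by assigning to an arrow `φ : B → A` of `C` the automorphism `α_{deg_Fr(φ)} ∈ Aut_C(B)`"), transported
to the model Frobenioid `C` of the data `(D, Φ, B, Div_B : B → Φ^gp)` of Theorem 5.2 (i) p. 100
[cite: MochizukiFrdI2008, Thm. 5.2(i) p.100] (tree: `ModelFrobenioid Φ B DivB`, abc-iut-L1-t2).

PROOF-ONLY (no definitions), abc-iut cell seat abc-iut-f-049.  `not_isSlim_of_rootFamily`: suppose given, for
every `n ∈ ℕ_{≥1}` and every `X ∈ Ob(D)`, an invertible element `rₙ(X) ∈ B(X)` with `Div_B(rₙ(X)) = 0`, natural in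
`X` (`B(f)(rₙ(Y)) = rₙ(X)`), forming a ROOT SYSTEM (`r_{n·k}(X)^k = rₙ(X)`) with `r₁(X₀) ≠ 1` for some `X₀`.  Then
the units `(1, id, 0, r_{deg_Fr(γ)}(X))` at the objects `γ : (X, ξ) → (X₀, 0)` of the slice `C_{(X₀,0)}` form a
natural automorphism of `C_{(X₀,0)} → C` (naturality along `m` is exactly the root relation, since
`u_{m ∘ r} = B(Base m)(r) · u_m` while `u_{r' ∘ m} = u_m · r'^{deg_Fr(m)}`), nontrivial at `id_{(X₀,0)}`: so `C` is
not slim.  This is the kernel form of "condition (b) `⋂ₙ O^×(A)ⁿ = {1}` of Prop. 1.13 (iii) cannot be dropped"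
for model Frobenioids; it is used by abc-iut-f-049's interface countermodel to the closure of [EtTh] Thm. 3.7 (iv)
(`EtaleTheta/TemperedFrobenioidThm37ivInterfaceNegative.lean`).  Nothing here bears on [IUTchIII] Cor. 3.12.
-/

namespace Literature.AlgebraicGeometry.Frobenioids

namespace ModelFrobenioid

open CategoryTheory Opposite

universe w v u

variable {D : Type u} [Category.{v} D] {Φ B : Dᵒᵖ ⥤ CommMonCat.{w}} {DivB : B ⟶ monoidGp Φ}

/-- **Remark 1.13.1 for model Frobenioids**: a natural, `Div_B`-trivial, invertible ROOT SYSTEM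
`rₙ(X) ∈ B(X)` (`r_{n·k}(X)^k = rₙ(X)`) with `r₁(X₀) ≠ 1` yields a nontrivial automorphism
`γ ↦ (1, id, 0, r_{deg_Fr(γ)})` of the natural functor `C_{(X₀,0)} → C`; hence the model Frobenioid `C` is NOT
slim. [cite: MochizukiFrdI2008, Rem. 1.13.1 p.40] -/
theorem not_isSlim_of_rootFamily (r rinv : ℕ+ → ∀ X : Dᵒᵖ, (B.obj X : Type w))
    (hinv : ∀ n X, r n X * rinv n X = 1)
    (hnat : ∀ (n : ℕ+) {X Y : Dᵒᵖ} (f : X ⟶ Y), (B.map f).hom (r n X) = r n Y)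
    (hdiv : ∀ n X, divB Φ B DivB X (r n X) = 1)
    (hroot : ∀ (n k : ℕ+) X, r (n * k) X ^ (k : ℕ) = r n X)
    {X₀ : D} (h1 : r 1 (op X₀) ≠ 1) :
    ¬ IsSlim (ModelFrobenioid Φ B DivB) := by
  intro hslim
  have hdivinv : ∀ n X, divB Φ B DivB X (rinv n X) = 1 := fun n X => by
    have h := congrArg (divB Φ B DivB X) (hinv n X)
    rw [map_mul, hdiv, one_mul, map_one] at h
    exact h
  -- the unit endomorphism `(1, id, 0, u)` of an object `X` for `Div_B(u) = 0`
  have relU : ∀ (X : ModelFrobenioid Φ B DivB) (u : B.obj (op X.base)), divB Φ B DivB (op X.base) u = 1 →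
      X.cls ^ ((1 : ℕ+) : ℕ) * Algebra.GrothendieckGroup.of (1 : Φ.obj (op X.base)) =
        pullGp Φ (𝟙 X.base) X.cls * divB Φ B DivB (op X.base) u := by
    intro X u hu
    rw [PNat.one_coe, pow_one, map_one, mul_one, hu, mul_one, pullGp_id]
  let unitHom : ∀ (X : ModelFrobenioid Φ B DivB) (u : B.obj (op X.base)),
      divB Φ B DivB (op X.base) u = 1 → (X ⟶ X) := fun X u hu => ⟨1, 𝟙 X.base, 1, u, relU X u hu⟩
  have unitHom_comp_eq_id : ∀ (X : ModelFrobenioid Φ B DivB) (u u' : B.obj (op X.base))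
      (hu : divB Φ B DivB (op X.base) u = 1) (hu' : divB Φ B DivB (op X.base) u' = 1), u' * u = 1 →
      unitHom X u hu ≫ unitHom X u' hu' = 𝟙 X := by
    intro X u u' hu hu' huu'
    apply hom_ext
    · rfl
    · exact Category.id_comp _
    · change (Φ.map (𝟙 _ : _ ⟶ _).op).hom 1 * 1 ^ ((1 : ℕ+) : ℕ) = (1 : Φ.obj (op X.base))
      rw [map_one, one_pow, mul_one]
    · change (B.map (𝟙 _ : _ ⟶ _).op).hom u' * u ^ ((1 : ℕ+) : ℕ) = (1 : B.obj (op X.base))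
      rw [op_id, B.map_id, CommMonCat.hom_id, MonoidHom.id_apply, PNat.one_coe, pow_one, huu']
  -- the automorphism of `C_A → C`, `A := (X₀, 0)`
  let A : ModelFrobenioid Φ B DivB := ⟨X₀, 1⟩
  let ι : ∀ U : Over A, U.left ≅ U.left := fun U =>
    { hom := unitHom U.left (r (degFr U.hom) (op U.left.base)) (hdiv _ _)
      inv := unitHom U.left (rinv (degFr U.hom) (op U.left.base)) (hdivinv _ _)
      hom_inv_id := unitHom_comp_eq_id _ _ _ (hdiv _ _) (hdivinv _ _) (by rw [mul_comm, hinv])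
      inv_hom_id := unitHom_comp_eq_id _ _ _ (hdivinv _ _) (hdiv _ _) (hinv _ _) }
  let α : Over.forget A ≅ Over.forget A := NatIso.ofComponents ι (by
    intro U U' m
    -- `deg_Fr(U.hom) = deg_Fr(U'.hom) · deg_Fr(m.left)` from `m.left ≫ U'.hom = U.hom`
    have hdeg : degFr U.hom = degFr U'.hom * degFr m.left := by
      have h := congrArg degFr (Over.w m)
      exact h.symm
    change m.left ≫ unitHom U'.left (r (degFr U'.hom) (op U'.left.base)) (hdiv _ _) =
      unitHom U.left (r (degFr U.hom) (op U.left.base)) (hdiv _ _) ≫ m.left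
    apply hom_ext
    · change 1 * degFr m.left = degFr m.left * 1
      rw [mul_one, one_mul]
    · change baseMap m.left ≫ 𝟙 _ = 𝟙 _ ≫ baseMap m.left
      rw [Category.id_comp, Category.comp_id]
    · change (Φ.map (baseMap m.left).op).hom 1 * div m.left ^ ((1 : ℕ+) : ℕ) =
        (Φ.map (𝟙 _ : _ ⟶ _).op).hom (div m.left) * 1 ^ (degFr m.left : ℕ)
      rw [op_id, Φ.map_id, CommMonCat.hom_id, MonoidHom.id_apply, one_pow, mul_one, map_one, one_mul,
        PNat.one_coe, pow_one]
    · change (B.map (baseMap m.left).op).hom (r (degFr U'.hom) (op U'.left.base)) * unit m.left ^ ((1 : ℕ+) : ℕ) =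
        (B.map (𝟙 _ : _ ⟶ _).op).hom (unit m.left) * r (degFr U.hom) (op U.left.base) ^ (degFr m.left : ℕ)
      rw [op_id, B.map_id, CommMonCat.hom_id, MonoidHom.id_apply, hnat, PNat.one_coe, pow_one, hdeg, hroot,
        mul_comm])
  have hα : α = Iso.refl _ := hslim.isRigid_forget A α
  have h := congrArg (fun i : Over.forget A ≅ Over.forget A => unit (i.hom.app (Over.mk (𝟙 A)))) hα
  exact h1 h

end ModelFrobenioid

end Literature.AlgebraicGeometry.Frobenioids
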